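/- Free-seat work of WIDTH SEAT 2/3 `ym-line-cbag-p1-w2` (prover-ym-line-cbag-p1-w2-g16-0), route `EguchiKawaiDirectionLadder`
(ideator ym-idea-2, LINE 8), crux `DirectionIncrement` (stmt-QuantumFields-27725), stub B1 `SingleLinkRigidity`: block choice from
centre symmetry, part 1/3 (cells, block labels, separation).  ROUTE-INDEPENDENT (no Theses import).  B1 is NOT proved here; nothing
bears on the YM mass gap. -/
import Literature.Barriers.QuantumFields.EguchiKawaiBreakdownLowerBound
import HarnessLib

/-!
# Stub B1 of crux `DirectionIncrement`, input (BLOCKS), part 1: fine cells, block labels, separation across blocks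

Toward `blocks_from_centre_symmetry` (part 3, `EguchiKawaiDirectionLadderSingleLinkBlocks.lean`): the hypothesis (BLOCKS) of the
reduction `singleLinkRigidity_of_blocks_of_offDiagSmallBall` (`EguchiKawaiDirectionLadderSingleLinkReductionCore.lean`).  Here:

* angular coordinate `angleOf z = π − arg z ∈ [0, 2π)` and `|z − z'|² = 2 − 2cos(φ − φ')` for unit `z, z'`;
* `cellOf K z = ⌊angleOf z / (2π/K)⌋ < K` with `c·w ≤ φ < (c+1)·w`;
* `blockLabel m M r z : Option (Fin m)` — `K = m·M` cells, arcs of `M` consecutive cells starting at the cells `≡ r (mod M)`, whose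
  first cell is a COLLAR (`none`); otherwise the arc index `⌊relPos/M⌋`, `relPos = (cell + K − r) mod K`;
* `blockLabel_separated`: two unit complex numbers with different non-collar labels satisfy `|z − z'|² ≥ 2 − 2cos(2π/(mM))`
  (different arcs and off the collars ⇒ cyclic cell distance in `[2, K − 2]` ⇒ angle difference in `[w, 2π − w]` modulo `2π`).

Deterministic and `N`-free.  Barrier-ledger line (`EguchiKawaiBreakdown`); nothing here bears on the Yang–Mills mass gap.
-/

set_option autoImplicit false

noncomputable section

open scoped Real
open Finset

namespace Summit.QuantumFields.YangMills.Theorems.EguchiKawaiDirectionLadder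

/-! ### A. Trigonometry of unit complex numbers -/

/-- A unit complex number is `e^{i arg}`. -/
theorem eq_exp_arg_of_norm_eq_one {z : ℂ} (hz : ‖z‖ = 1) : z = Complex.exp (Complex.arg z * Complex.I) := by
  have h := Complex.norm_mul_exp_arg_mul_I z
  rw [hz, Complex.ofReal_one, one_mul] at h
  exact h.symm

/-- `|e^{ia} − e^{ib}|² = 2 − 2 cos(a − b)`. -/
theorem norm_exp_sub_exp_sq (a b : ℝ) :
    ‖Complex.exp (a * Complex.I) - Complex.exp (b * Complex.I)‖ ^ 2 = 2 - 2 * Real.cos (a - b) := by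
  rw [Complex.sq_norm, Complex.normSq_apply, Complex.sub_re, Complex.sub_im, Complex.exp_ofReal_mul_I_re,
    Complex.exp_ofReal_mul_I_re, Complex.exp_ofReal_mul_I_im, Complex.exp_ofReal_mul_I_im, Real.cos_sub]
  nlinarith [Real.sin_sq_add_cos_sq a, Real.sin_sq_add_cos_sq b]

/-- For unit complex numbers, `|z − z'|² = 2 − 2 cos(arg z − arg z')`. -/
theorem norm_sub_sq_of_norm_eq_one {z z' : ℂ} (hz : ‖z‖ = 1) (hz' : ‖z'‖ = 1) :
    ‖z - z'‖ ^ 2 = 2 - 2 * Real.cos (Complex.arg z - Complex.arg z') := by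
  conv_lhs => rw [eq_exp_arg_of_norm_eq_one hz, eq_exp_arg_of_norm_eq_one hz']
  exact norm_exp_sub_exp_sq _ _

/-- `cos x ≤ cos w` for `x ∈ [w, 2π − w]`, `0 ≤ w`. -/
theorem cos_le_cos_of_mem_Icc {w x : ℝ} (hw0 : 0 ≤ w) (hx1 : w ≤ x) (hx2 : x ≤ 2 * π - w) :
    Real.cos x ≤ Real.cos w := by
  by_cases hxπ : x ≤ π
  · exact Real.cos_le_cos_of_nonneg_of_le_pi hw0 hxπ hx1
  · push Not at hxπ
    rw [← Real.cos_two_pi_sub x]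
    exact Real.cos_le_cos_of_nonneg_of_le_pi hw0 (by linarith) (by linarith)

/-- `cos x ≤ cos w` for `|x| ∈ [w, 2π − w]`. -/
theorem cos_le_cos_of_mem_Icc_abs {w x : ℝ} (hw0 : 0 ≤ w) (hx1 : w ≤ |x|) (hx2 : |x| ≤ 2 * π - w) :
    Real.cos x ≤ Real.cos w := by
  rw [← Real.cos_abs x]
  exact cos_le_cos_of_mem_Icc hw0 hx1 hx2

/-- The real part of `e^{−iψ} Σ_j d_j` for unit `d_j = e^{iθ_j}` is `Σ_j cos(θ_j − ψ)`, and it is at most `|Σ_j d_j|`. -/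
theorem sum_cos_arg_sub_le_norm_sum {N : ℕ} (d : Fin N → ℂ) (hd : ∀ j, ‖d j‖ = 1) (ψ : ℝ) :
    ∑ j, Real.cos (Complex.arg (d j) - ψ) ≤ ‖∑ j, d j‖ := by
  have h : ∑ j, Real.cos (Complex.arg (d j) - ψ) = (Complex.exp (-(ψ * Complex.I)) * ∑ j, d j).re := by
    rw [Finset.mul_sum, Complex.re_sum]
    refine Finset.sum_congr rfl fun j _ => ?_
    conv_rhs => rw [eq_exp_arg_of_norm_eq_one (hd j), ← Complex.exp_add]
    rw [show -(↑ψ * Complex.I) + ↑(Complex.arg (d j)) * Complex.I = ↑(Complex.arg (d j) - ψ) * Complex.I by push_cast; ring,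
      Complex.exp_ofReal_mul_I_re]
  rw [h]
  refine (Complex.re_le_norm _).trans ?_
  have hn : ‖Complex.exp (-(↑ψ * Complex.I))‖ = 1 := by
    rw [show -(↑ψ * Complex.I) = ↑(-ψ) * Complex.I by push_cast; ring, Complex.norm_exp_ofReal_mul_I]
  rw [norm_mul, hn, one_mul]

/-! ### B. Fine cells on the circle -/

/-- The angular coordinate `φ(z) = π − arg z ∈ [0, 2π)` of a complex number (orientation reversed so that the range is half-open
at the right end; only differences of angles and their cosines matter below). -/
def angleOf (z : ℂ) : ℝ := π - Complex.arg z

/-- `0 ≤ φ(z)`. -/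
theorem angleOf_nonneg (z : ℂ) : 0 ≤ angleOf z := by
  have := Complex.arg_le_pi z; unfold angleOf; linarith

/-- `φ(z) < 2π`. -/
theorem angleOf_lt_two_pi (z : ℂ) : angleOf z < 2 * π := by
  have := Complex.neg_pi_lt_arg z; unfold angleOf; linarith

/-- For unit complex numbers, `|z − z'|² = 2 − 2cos(φ(z) − φ(z'))`. -/
theorem norm_sub_sq_eq_angleOf {z z' : ℂ} (hz : ‖z‖ = 1) (hz' : ‖z'‖ = 1) :
    ‖z - z'‖ ^ 2 = 2 - 2 * Real.cos (angleOf z - angleOf z') := by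
  rw [norm_sub_sq_of_norm_eq_one hz hz', angleOf, angleOf, ← Real.cos_neg]
  congr 2; ring

/-- The fine cell of `z` among `K` equal arcs of angular width `2π/K`: `⌊φ(z) / (2π/K)⌋`. -/
def cellOf (K : ℕ) (z : ℂ) : ℕ := ⌊angleOf z / (2 * π / K)⌋₊

/-- Cells are indexed below `K` (for `K ≥ 1`). -/
theorem cellOf_lt {K : ℕ} (hK : 0 < K) (z : ℂ) : cellOf K z < K := by
  have hw : 0 < 2 * π / K := by positivity
  rw [cellOf, Nat.floor_lt (div_nonneg (angleOf_nonneg z) hw.le), div_lt_iff₀ hw]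
  have := angleOf_lt_two_pi z
  have hKw : 2 * π / K * K = 2 * π := by field_simp
  nlinarith

/-- Cell bounds: `c·w ≤ φ(z) < (c+1)·w` with `w = 2π/K`, `c = cellOf K z`. -/
theorem cellOf_mul_le {K : ℕ} (hK : 0 < K) (z : ℂ) :
    (cellOf K z : ℝ) * (2 * π / K) ≤ angleOf z ∧ angleOf z < ((cellOf K z : ℝ) + 1) * (2 * π / K) := by
  have hw : 0 < 2 * π / K := by positivity
  have h0 : 0 ≤ angleOf z / (2 * π / K) := div_nonneg (angleOf_nonneg z) hw.le
  constructor
  · have := Nat.floor_le h0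
    rw [cellOf]
    rwa [le_div_iff₀ hw] at this
  · have := Nat.lt_floor_add_one (angleOf z / (2 * π / K))
    rw [cellOf]
    rwa [div_lt_iff₀ hw] at this

/-! ### C. Block labels: `m` arcs of `M` cells each, one collar cell per arc, shifted by `r` -/

/-- The position of cell `c` relative to the shift `r` on the cycle of `K = m·M` cells. -/
def relPos (m M r c : ℕ) : ℕ := (c + m * M - r) % (m * M)

/-- `relPos < m·M`. -/
theorem relPos_lt {m M r c : ℕ} (hmM : 0 < m * M) : relPos m M r c < m * M := Nat.mod_lt _ hmM

/-- The block label of `z` for the parameters `(m, M, r)`: `none` on the collar cells (`relPos ≡ 0 mod M`), otherwise the index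
`⌊relPos / M⌋ < m` of the arc of `M` consecutive cells containing it. -/
def blockLabel (m M r : ℕ) (z : ℂ) : Option (Fin m) :=
  if h : 0 < m * M ∧ relPos m M r (cellOf (m * M) z) % M ≠ 0 then
    some ⟨relPos m M r (cellOf (m * M) z) / M,
      Nat.div_lt_of_lt_mul ((relPos_lt h.1).trans_eq (Nat.mul_comm m M))⟩
  else none

/-- `(x+1)/M = x/M` unless `x + 1 ≡ 0 (mod M)`. -/
theorem succ_div_eq_of_mod_ne {M x : ℕ} (h : (x + 1) % M ≠ 0) : (x + 1) / M = x / M := by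
  rw [Nat.succ_div, if_neg (fun hd => h (Nat.mod_eq_zero_of_dvd hd)), Nat.add_zero]

/-- Elementary: two positions both off the collar residue (`x % M ≠ 0`, `y % M ≠ 0`) and in different arcs (`x / M ≠ y / M`)
are at distance at least `2`. -/
theorem two_le_dist_of_div_ne {M x y : ℕ} (hx : x % M ≠ 0) (hy : y % M ≠ 0) (hne : x / M ≠ y / M) :
    2 ≤ (max x y) - (min x y) := by
  by_contra hlt
  push Not at hlt
  rcases le_total x y with hxy | hxy
  · rw [max_eq_right hxy, min_eq_left hxy] at hlt
    rcases Nat.eq_or_lt_of_le hxy with h0 | h0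
    · exact hne (by rw [h0])
    · have hyx : y = x + 1 := by omega
      subst hyx
      exact hne (succ_div_eq_of_mod_ne hy).symm
  · rw [max_eq_left hxy, min_eq_right hxy] at hlt
    rcases Nat.eq_or_lt_of_le hxy with h0 | h0
    · exact hne (by rw [h0])
    · have hyx : x = y + 1 := by omega
      subst hyx
      exact hne (succ_div_eq_of_mod_ne hx)

/-- … and at cyclic distance at most `K − 2`: `max − min ≤ K − 2` for `x, y < K` off the collar residue (`0 % M = 0`). -/
theorem dist_le_sub_two_of_mod_ne {M K x y : ℕ} (hxK : x < K) (hyK : y < K) (hx : x % M ≠ 0) (hy : y % M ≠ 0) :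
    (max x y) - (min x y) ≤ K - 2 := by
  have hx0 : x ≠ 0 := fun h => hx (by rw [h, Nat.zero_mod])
  have hy0 : y ≠ 0 := fun h => hy (by rw [h, Nat.zero_mod])
  rcases le_total x y with hxy | hxy
  · rw [max_eq_right hxy, min_eq_left hxy]; omega
  · rw [max_eq_left hxy, min_eq_right hxy]; omega

/-- Unfolding a non-collar label: `blockLabel = some ⟨relPos / M, _⟩` with `relPos % M ≠ 0` and `0 < m·M`. -/
theorem blockLabel_eq_some_iff {m M r : ℕ} {z : ℂ} {a : Fin m} :
    blockLabel m M r z = some a ↔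
      0 < m * M ∧ relPos m M r (cellOf (m * M) z) % M ≠ 0 ∧ relPos m M r (cellOf (m * M) z) / M = a.val := by
  unfold blockLabel
  split_ifs with h
  · simp only [Option.some.injEq, h, ne_eq, not_false_eq_true, true_and]
    constructor
    · rintro rfl; rfl
    · intro ha; exact Fin.ext ha
  · simp only [false_iff, not_and]
    intro h1 h2
    exact absurd ⟨h1, h2⟩ h

/-- Unfolding a non-collar label: `blockLabel ≠ none` iff `0 < m·M` and `relPos % M ≠ 0`. -/
theorem blockLabel_ne_none_iff {m M r : ℕ} {z : ℂ} :
    blockLabel m M r z ≠ none ↔ 0 < m * M ∧ relPos m M r (cellOf (m * M) z) % M ≠ 0 := by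
  unfold blockLabel
  split_ifs with h
  · simp [h]
  · simp only [ne_eq, not_true_eq_false, false_iff]; exact h

/-- The cosine estimate behind the separation: two angles in cells `c, c'` (width `w = 2π/K`) whose positions `x, y`
relative to the shift satisfy `2 ≤ |x − y| ≤ K − 2` have `cos(φ − φ') ≤ cos w`. -/
theorem cos_sub_le_cos_of_cells {K : ℕ} {w φ φ' : ℝ} (hw : 0 < w) (hKw : (K : ℝ) * w = 2 * π)
    {c c' x y r : ℕ} (q q' : ℕ)
    (hc : (K : ℝ) * q + x = c + K - r) (hc' : (K : ℝ) * q' + y = c' + K - r)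
    (hφ1 : (c : ℝ) * w ≤ φ) (hφ2 : φ < ((c : ℝ) + 1) * w) (hφ'1 : (c' : ℝ) * w ≤ φ') (hφ'2 : φ' < ((c' : ℝ) + 1) * w)
    (hd1 : (2 : ℝ) ≤ |(x : ℝ) - y|) (hd2 : |(x : ℝ) - y| ≤ K - 2) :
    Real.cos (φ - φ') ≤ Real.cos w := by
  -- remove the integer number of full turns
  set v : ℝ := φ - φ' - ((q : ℤ) - q' : ℤ) * (2 * π) with hv
  have hcos : Real.cos (φ - φ') = Real.cos v := by
    rw [hv, Real.cos_sub_int_mul_two_pi]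
  rw [hcos]
  -- v is within w of (x - y) w
  have hv' : v = φ - φ' - ((q : ℝ) - q') * ((K : ℝ) * w) := by
    rw [hv, hKw]; push_cast; ring
  have hlow : ((x : ℝ) - y) * w - w < v := by
    rw [hv']; nlinarith
  have hup : v < ((x : ℝ) - y) * w + w := by
    rw [hv']; nlinarith
  apply cos_le_cos_of_mem_Icc_abs hw.le
  · -- w ≤ |v|
    rcases le_or_gt 0 ((x : ℝ) - y) with hxy | hxy
    · rw [abs_of_nonneg hxy] at hd1
      have : w ≤ v := by nlinarith
      exact this.trans (le_abs_self v)
    · rw [abs_of_neg hxy] at hd1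
      have : w ≤ -v := by nlinarith
      exact this.trans (neg_le_abs v)
  · -- |v| ≤ 2π - w = (K - 1) w
    rw [abs_le]
    rcases le_or_gt 0 ((x : ℝ) - y) with hxy | hxy
    · rw [abs_of_nonneg hxy] at hd2
      constructor <;> nlinarith
    · rw [abs_of_neg hxy] at hd2
      constructor <;> nlinarith

/-- **Separation across blocks.**  For unit complex numbers `z, z'` carrying different (non-collar) block labels,
`|z − z'|² ≥ 2 − 2cos(2π/(m·M))`. -/
theorem blockLabel_separated {m M r : ℕ} (hr : r < m * M) {z z' : ℂ} (hz : ‖z‖ = 1) (hz' : ‖z'‖ = 1)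
    (hne : blockLabel m M r z ≠ blockLabel m M r z') (h1 : blockLabel m M r z ≠ none) (h2 : blockLabel m M r z' ≠ none) :
    2 - 2 * Real.cos (2 * π / (m * M : ℕ)) ≤ ‖z - z'‖ ^ 2 := by
  obtain ⟨hK, hx⟩ := blockLabel_ne_none_iff.1 h1
  obtain ⟨-, hy⟩ := blockLabel_ne_none_iff.1 h2
  set K : ℕ := m * M with hKdef
  set c := cellOf K z with hcdef
  set c' := cellOf K z' with hc'def
  set x := relPos m M r c with hxdef
  set y := relPos m M r c' with hydef
  -- different arcs
  have hdiv : x / M ≠ y / M := by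
    intro hxy
    obtain ⟨a, ha⟩ := Option.ne_none_iff_exists'.1 h1
    obtain ⟨b, hb⟩ := Option.ne_none_iff_exists'.1 h2
    have ha' := (blockLabel_eq_some_iff.1 ha).2.2
    have hb' := (blockLabel_eq_some_iff.1 hb).2.2
    apply hne
    rw [ha, hb]
    congr 1
    exact Fin.ext (by rw [← ha', ← hb']; exact hxy)
  -- cyclic distance bounds, in ℝ
  have hxK : x < K := relPos_lt hK
  have hyK : y < K := relPos_lt hK
  have hdn1 := two_le_dist_of_div_ne hx hy hdiv
  have hdn2 := dist_le_sub_two_of_mod_ne (K := K) hxK hyK hx hy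
  have hK2 : 2 ≤ K := by
    rcases Nat.lt_or_ge K 2 with h | h
    · exfalso; omega
    · exact h
  have hcast : (((max x y - min x y : ℕ) : ℝ)) = |(x : ℝ) - y| := by
    rw [Nat.cast_sub (min_le_max), Nat.cast_max, Nat.cast_min, max_sub_min_eq_abs']
  have hd1 : (2 : ℝ) ≤ |(x : ℝ) - y| := by rw [← hcast]; exact_mod_cast hdn1
  have hd2 : |(x : ℝ) - y| ≤ K - 2 := by
    rw [← hcast]
    have : ((max x y - min x y : ℕ) : ℝ) ≤ ((K - 2 : ℕ) : ℝ) := by exact_mod_cast hdn2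
    rwa [Nat.cast_sub hK2] at this
  -- cells versus positions
  have hKpos : (0 : ℝ) < K := by exact_mod_cast hK
  set w : ℝ := 2 * π / K with hw
  have hwpos : 0 < w := by positivity
  have hKw : (K : ℝ) * w = 2 * π := by rw [hw]; field_simp
  have hcK : c < K := cellOf_lt hK z
  have hc'K : c' < K := cellOf_lt hK z'
  have hqc : (K : ℝ) * ((c + K - r) / K : ℕ) + x = c + K - r := by
    have h := Nat.div_add_mod (c + K - r) K
    have hr' : r ≤ c + K := by omega
    have : ((K * ((c + K - r) / K) + (c + K - r) % K : ℕ) : ℝ) = ((c + K - r : ℕ) : ℝ) := by rw [h]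
    rw [Nat.cast_sub hr'] at this
    push_cast at this ⊢
    rw [hxdef, relPos]
    linarith
  have hqc' : (K : ℝ) * ((c' + K - r) / K : ℕ) + y = c' + K - r := by
    have h := Nat.div_add_mod (c' + K - r) K
    have hr' : r ≤ c' + K := by omega
    have : ((K * ((c' + K - r) / K) + (c' + K - r) % K : ℕ) : ℝ) = ((c' + K - r : ℕ) : ℝ) := by rw [h]
    rw [Nat.cast_sub hr'] at this
    push_cast at this ⊢
    rw [hydef, relPos]
    linarith
  obtain ⟨hφ1, hφ2⟩ := cellOf_mul_le hK z
  obtain ⟨hφ'1, hφ'2⟩ := cellOf_mul_le hK z'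
  have hcosle := cos_sub_le_cos_of_cells hwpos hKw _ _ hqc hqc' hφ1 hφ2 hφ'1 hφ'2 hd1 hd2
  rw [norm_sub_sq_eq_angleOf hz hz']
  linarith

end Summit.QuantumFields.YangMills.Theorems.EguchiKawaiDirectionLadder

end
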